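import Summits.QuantumAdvantage.QuantumAdvantage.Theorems.WbwObfuscatedGluedTreesKowGenVocabulary

/-!
# Stub `stub_coinSchedule` — the coin schedule of an admissible `FP` datum is the obfuscator's budget along an
# `FP`, unbounded input-length schedule
# (crux `WbwObfuscatedGluedTrees`, stmt-QuantumAdvantage-2340; line `knowledge-of-walk-split`, stage 4, lead c3)

Registered stub of the stage-4 skeleton (target `…Generator.Residual.ResidualAudit`).  For master data `D`
admissible for the obfuscator `O` (`GenAdmissible D O P`) with `FP` schedules (`FPData D.params O P`), the
input-length schedule `m n := |encodeInput (ς (t n), ⟨2N, Γ (t n) 0^{4 t n}⟩)|` (the obfuscator's input on the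
all-zero key material) is

* `FP` on unary numerals (`FPData.secParam`, `FPData.keyPartLen`, `FPData.circ`, `FPData.zeros`, `strLength`);
* unbounded along every tail (`m n ≥ ς (t n) ≥ n^c` eventually, clause (2) of `GenAdmissible`);
* and, eventually in `n`, `D.c n = O.coinLen (m n)` (clause (8) of `GenAdmissible` at the all-zero key material;
  `O.coins κ C = O.coinLen |encodeInput (κ, C)|` by definition).

Generic bookkeeping; no crux content.
-/

set_option linter.dupNamespace false

noncomputable section

namespace Summit.QuantumAdvantage.QuantumAdvantage.Theorems.WbwObfuscatedGluedTrees.KnowledgeOfWalk.Residual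

open Literature.Computability.Cryptography Literature.Computability.Complexity Filter Asymptotics
open Literature.Computability.Cryptography.ObfuscatedGluedTrees
open Literature.Computability.QuantumComplexity
open Literature.Computability.Complexity.CodeFP (unE bitE pairE strE natE)
open Summit.QuantumAdvantage.QuantumAdvantage.Theorems.WbwObfuscatedGluedTrees.KnowledgeOfWalk.Generator

/-- **Stub `stub_coinSchedule`**: for admissible master data with `FP` schedules, the coin schedule `D.c` is,
eventually, the obfuscator's coin budget `O.coinLen` along the `FP`, unbounded input-length schedule
`m n = |encodeInput (ς (t n), ⟨2N, Γ (t n) 0^{4 t n}⟩)|`. [folklore] -/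
theorem stub_coinSchedule :
    ∀ (D : MasterData) (O : CircuitObfuscator) (P : PuncturablePRFScheme),
      GenAdmissible D O P → FPData D.params O P →
      ∃ m : ℕ → ℕ, CodeFP unE unE m ∧ (∀ B k : ℕ, ∃ n, k < n ∧ B < m n) ∧
        ∃ n₀ : ℕ, ∀ n, n₀ ≤ n → D.c n = O.coinLen (m n) := by
  intro D O P hadm hFP
  refine ⟨fun n => (CircuitObfuscator.encodeInput (D.ς (D.t n),
    (⟨D.Nℓ (D.t n) + D.Nℓ (D.t n), D.Γ (D.t n) (List.replicate (4 * D.t n) false)⟩ : SizedCircuit))).length,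
    ?_, ?_, ?_⟩
  · -- `m` is `FP` on unary numerals
    have ht : CodeFP unE unE (fun n => 4 * D.t n) := (CodeFP.unMulConst 4).comp hFP.keyPartLen
    have hz : CodeFP unE strE (fun n => List.replicate (4 * D.t n) false) := FPData.zeros.comp ht
    have hp : CodeFP unE (pairE unE strE) (fun n => (n, List.replicate (4 * D.t n) false)) :=
      (CodeFP.id unE).pair hz
    -- (no type ascriptions with placeholders below: unifying a `Σ`-literal with a holed arity is slow)
    have hC := hFP.circ.comp hp
    have hin := hFP.secParam.pair hC
    have hstr : CodeFP unE strE (fun n => CircuitObfuscator.encodeInput (D.ς (D.t n),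
        (⟨D.Nℓ (D.t n) + D.Nℓ (D.t n), D.Γ (D.t n) (List.replicate (4 * D.t n) false)⟩ : SizedCircuit))) :=
      hin.recodeOut fun _ => rfl
    exact CodeFP.strLength.comp hstr
  · -- `m` is unbounded along every tail
    intro B k
    obtain ⟨c, hc, hev⟩ := hadm.2.1
    have hT : Tendsto (fun n : ℕ => (n : ℝ) ^ c) atTop atTop :=
      (tendsto_rpow_atTop hc).comp tendsto_natCast_atTop_atTop
    obtain ⟨n, hkn, hBn, hle⟩ := ((eventually_gt_atTop k).and ((hT.eventually_gt_atTop (B : ℝ)).and hev)).exists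
    refine ⟨n, hkn, ?_⟩
    have h1 : (B : ℝ) < (D.ς (D.t n) : ℝ) := hBn.trans_le hle
    have h2 : B < D.ς (D.t n) := by exact_mod_cast h1
    have h3 : D.ς (D.t n) ≤ (CircuitObfuscator.encodeInput (D.ς (D.t n),
        (⟨D.Nℓ (D.t n) + D.Nℓ (D.t n), D.Γ (D.t n) (List.replicate (4 * D.t n) false)⟩ : SizedCircuit))).length := by
      rw [CircuitObfuscator.encodeInput, length_boolPair,
        show (Computability.unaryEncodeNat (D.ς (D.t n))).length = D.ς (D.t n) from CodeFP.length_unE _]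
      omega
    exact lt_of_lt_of_le h2 h3
  · -- eventually the coin schedule is the budget on `m`
    obtain ⟨n₀, hn₀⟩ := hadm.2.2.2.2.2.2.2
    refine ⟨n₀, fun n hn => ?_⟩
    exact (hn₀ n hn (List.replicate (4 * D.t n) false) (List.length_replicate ..)).2

end Summit.QuantumAdvantage.QuantumAdvantage.Theorems.WbwObfuscatedGluedTrees.KnowledgeOfWalk.Residual

end
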